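import Mathlib
import HarnessLib
import Summits.NavierStokesRegularity.NavierStokesRegularity.Theorems.PoloidalWindowDoorLrcModEntireQ4CurvedTranslationFlat
import Summits.NavierStokesRegularity.NavierStokesRegularity.Theorems.PoloidalWindowDoorLrcModEntireQ4CurvedVerticalEntrance

/-!
# Route `PoloidalWindowDoor`, item `LrcModEntire` (stmt-NavierStokesRegularity-20428) — CELL (Q4-CURVED-APERIODIC-VERTICAL), ¬X_H residue, TRANSLATION-FLAT CHILD IN
# REGISTRY CURRENCY (v18 candidate)

Cell ns-regularity-ideate, stub-worker seat ns-poloidal-K2-p2 g19 under the LEAD of item 20428 (ns-poloidal-K2-p3 g18); `--supports stmt-NavierStokesRegularity-20428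
--as helper`.

`stub_Q4curvedAperiodicVerticalCurvedLimitsTranslationFlat_closed` — the statement of the REGISTERED research slot `stub_Q4curvedAperiodicVerticalCurvedLimits` of
twist_split v17 (key bytes 1d2847cc234ecb9a, statement c93d3e2947318512) VERBATIM, with ONE conjunct appended LAST inside its `∃`-package: the literal
`Y_T := ∃ a : ℕ → ℝ, ∀ A ε : ℝ, 0 < ε → ∀ᶠ n in atTop, ∀ s : ℝ, |s| ≤ A → ‖deriv (deriv Γ) (a n + s)‖ ≤ ε` («the curvature of the base curve flattens along arcs
around a sequence of base points»; LEAD endorsement 2026-08-30T03:50:22Z, idea-crit-7 pre-ruling 03:51:00Z, refuter1 03:51:14Z: expected child hash 9442 /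
1f9d67d5feac5a0a).  If the LEAD keys other bytes, this file is re-issued against them.

Proof = destructuring + K2-p2 g18's ★★ `…CurvedTimeWebAt.curved_time_web_package` (B-TWP0c: the space–time web function over `Γ`) + port-2 g9's ★★
`…Q4CurvedVerticalEntrance.vertical_entrance` ((E1): the vertical critical sheet at the hot time makes the WHOLE cylinder `Γ × ℝ` horizontally critical) + this
seat's ★★ `…Q4CurvedTranslationFlat.false_of_translationFlat_curtain` (LEMMA T: translate along the flattening arcs, extract, H7).

WHAT THIS IS NOT: not a claim about Navier–Stokes regularity; the UNIFORMLY-CURVED sibling (`¬Y_T`) stays research; items 20428 / 19708 / 27893 OPEN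
(bears_on LADDER-NS N0).
-/

noncomputable section

set_option linter.dupNamespace false
set_option linter.style.longLine false

namespace Summit.NavierStokesRegularity.NavierStokesRegularity.Theorems.PoloidalWindowDoorLrcModEntireQ4CurvedAperiodicVerticalCurvedLimitsTranslationFlatStub

open Set Function Filter Topology Metric
open scoped RealInnerProductSpace InnerProductSpace Laplacian ContDiff
open Literature.Analysis Literature.Analysis.FluidPDE Literature.Analysis.UnboundedOperators
open Summit.NavierStokesRegularity.NavierStokesRegularity.Theorems
open Summit.NavierStokesRegularity.NavierStokesRegularity.Theorems.PoloidalWindowDoorLrcModEntireCurvedTimeWebAt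
open Summit.NavierStokesRegularity.NavierStokesRegularity.Theorems.PoloidalWindowDoorLrcModEntireQ4CurvedVerticalEntrance
open Summit.NavierStokesRegularity.NavierStokesRegularity.Theorems.PoloidalWindowDoorLrcModEntireQ4CurvedTranslationFlat

/-- ★★★ **THE TRANSLATION-FLAT CHILD OF `stub_Q4curvedAperiodicVerticalCurvedLimits` (registry currency).**  See the module docstring. -/
theorem stub_Q4curvedAperiodicVerticalCurvedLimitsTranslationFlat_closed : ∀ (C : ℝ) (v : ℝ → EuclideanSpace ℝ (Fin 3) → EuclideanSpace ℝ (Fin 3)) (W : Set (ℝ × EuclideanSpace ℝ (Fin 3))),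
      (Literature.Analysis.FluidPDE.HasTypeITimeDecay C v ∧
        ContinuousOn (Function.uncurry v) (Set.Iio (0 : ℝ) ×ˢ Set.univ) ∧
        (∀ s t : ℝ, s < t → t < 0 → ∀ x, v t x =
          Literature.Analysis.UnboundedOperators.heatExtension (v s) (t - s) x -
            Literature.Analysis.FluidPDE.oseenDuhamel 1 s v v t x) ∧
        (∀ t < 0, Literature.Analysis.FluidPDE.VectorCalculus.IsDivFree (v t)) ∧
        (∀ s < 0, ∀ y, ⟪Literature.Analysis.FluidPDE.curl (v s) y, EuclideanSpace.single 2 1⟫_ℝ = 0) ∧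
        v (-1) 0 2 ≠ 0 ∧ (∀ t < 0, ∀ x, Real.sqrt (-t) * |v t x 2| ≤ |v (-1) 0 2|) ∧
        (∀ h : EuclideanSpace ℝ (Fin 3), fderiv ℝ (v (-1)) 0 h 2 = 0) ∧
        (deriv (fun s => v s 0 2) (-1) = v (-1) 0 2 / 2 ∧ v (-1) 0 2 * (Δ (fun y => v (-1) y 2)) 0 ≤ 0)) →
      (IsOpen W ∧ W.Nonempty ∧ W ⊆ Set.Iio (0 : ℝ) ×ˢ Set.univ ∧
        (∀ z ∈ W, (Literature.Analysis.FluidPDE.curl (v z.1) z.2 ≠ 0 ∧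
            (fderiv ℝ (v z.1) z.2 (EuclideanSpace.single 0 1) 2 ≠ 0 ∨ fderiv ℝ (v z.1) z.2 (EuclideanSpace.single 1 1) 2 ≠ 0) ∧
            (fderiv ℝ (v z.1) z.2 (EuclideanSpace.single 2 1) 0 ≠ 0 ∨ fderiv ℝ (v z.1) z.2 (EuclideanSpace.single 2 1) 1 ≠ 0))) ∧
        (∀ m : ℝ → ℝ, ∀ W₁ : Set (ℝ × EuclideanSpace ℝ (Fin 3)), W₁ ⊆ W → IsOpen W₁ → W₁.Nonempty →
            ∃ z ∈ W₁, ∃ b : Fin 3, b ≠ 2 ∧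
              fderiv ℝ (v z.1) z.2 (EuclideanSpace.single 2 1) b ≠
                m z.1 * fderiv ℝ (v z.1) z.2 (EuclideanSpace.single b 1) 2) ∧
        (∀ z ∈ W, (fderiv ℝ (fun x => fderiv ℝ (v z.1) x (EuclideanSpace.single 2 1) 2) z.2 (EuclideanSpace.single 0 1) *
                fderiv ℝ (v z.1) z.2 (EuclideanSpace.single 1 1) 2 -
              fderiv ℝ (fun x => fderiv ℝ (v z.1) x (EuclideanSpace.single 2 1) 2) z.2 (EuclideanSpace.single 1 1) *
                fderiv ℝ (v z.1) z.2 (EuclideanSpace.single 0 1) 2 ≠ 0)) ∧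
        (∃ m : ℝ → ℝ → ℝ, ∀ z ∈ W, ∀ b : Fin 3, b ≠ 2 →
            fderiv ℝ (v z.1) z.2 (EuclideanSpace.single 2 1) b =
              m z.1 (z.2 2) * fderiv ℝ (v z.1) z.2 (EuclideanSpace.single b 1) 2)) →
      (∀ t < 0, ∀ x x' : EuclideanSpace ℝ (Fin 3), x 2 = x' 2 → ∀ b c : Fin 3, b ≠ 2 → c ≠ 2 →
        fderiv ℝ (v t) x (EuclideanSpace.single 2 1) b * fderiv ℝ (v t) x' (EuclideanSpace.single c 1) 2 =
          fderiv ℝ (v t) x' (EuclideanSpace.single 2 1) c * fderiv ℝ (v t) x (EuclideanSpace.single b 1) 2) →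
      (∀ (s z₀ σ M : ℝ) (K O : Set (EuclideanSpace ℝ (Fin 3))), s < 0 →
        ((σ = 1 ∨ σ = -1) ∧ IsCompact K ∧ K.Nonempty ∧ (∀ y ∈ K, y 2 = z₀ ∧ σ * v s y 2 = M) ∧
          IsOpen O ∧ K ⊆ O ∧ (∀ y ∈ O, y 2 = z₀ → σ * v s y 2 ≤ M) ∧
          (∀ y ∈ O, y 2 = z₀ → σ * v s y 2 = M → y ∈ K)) → False) →
      (∀ s < 0, ∀ y, ⟪fderiv ℝ (v s) y (Literature.Analysis.FluidPDE.curl (v s) y), EuclideanSpace.single 2 1⟫_ℝ = 0) →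
      IsClosed ({y : EuclideanSpace ℝ (Fin 3) | y 2 = 0 ∧ v (-1) y 2 = v (-1) 0 2}) →
      (∀ y ∈ {y : EuclideanSpace ℝ (Fin 3) | y 2 = 0 ∧ v (-1) y 2 = v (-1) 0 2}, fderiv ℝ (fun x => v (-1) x 2) y = 0) →
      (∀ K O : Set (EuclideanSpace ℝ (Fin 3)), IsCompact K → K.Nonempty → K ⊆ {y : EuclideanSpace ℝ (Fin 3) | y 2 = 0 ∧ v (-1) y 2 = v (-1) 0 2} →
        IsOpen O → K ⊆ O → O ∩ {y : EuclideanSpace ℝ (Fin 3) | y 2 = 0 ∧ v (-1) y 2 = v (-1) 0 2} ⊆ K → False) →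
      (∀ y ∈ {y : EuclideanSpace ℝ (Fin 3) | y 2 = 0 ∧ v (-1) y 2 = v (-1) 0 2}, ∀ r : ℝ, 0 < r →
        ∃ y' : EuclideanSpace ℝ (Fin 3), y' 2 = 0 ∧ dist y' y < r ∧ v (-1) y' 2 ≠ v (-1) 0 2) →
      (∀ y ∈ {y : EuclideanSpace ℝ (Fin 3) | y 2 = 0 ∧ v (-1) y 2 = v (-1) 0 2}, Literature.Analysis.FluidPDE.curl (v (-1)) y = 0) →
      ∀ (σ κ : ℝ) (y₁ : EuclideanSpace ℝ (Fin 3)) (c₁ : Fin 3), (σ = 1 ∨ σ = -1) → σ * v (-1) 0 2 = |v (-1) 0 2| → 0 < κ →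
        (∀ y : EuclideanSpace ℝ (Fin 3), y 2 = 0 → v (-1) y 2 = v (-1) 0 2 →
          fderiv ℝ (fderiv ℝ (fun x => σ * v (-1) x 2)) y (EuclideanSpace.single 0 1) (EuclideanSpace.single 0 1) +
            fderiv ℝ (fderiv ℝ (fun x => σ * v (-1) x 2)) y (EuclideanSpace.single 1 1) (EuclideanSpace.single 1 1) = -κ) →
        y₁ 2 = 0 → c₁ ≠ 2 → fderiv ℝ (v (-1)) y₁ (EuclideanSpace.single c₁ 1) 2 ≠ 0 →
        (∃ (γ : ℝ → EuclideanSpace ℝ (Fin 3)) (φ : ℕ → ℕ) (U : ℝ → EuclideanSpace ℝ (Fin 3) → EuclideanSpace ℝ (Fin 3)) (Γ νΓ : ℝ → EuclideanSpace ℝ (Fin 3))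
        (F : ℝ → EuclideanSpace ℝ (Fin 3) → ℝ) (R : ℝ → ℝ → ℝ) (r δ m : ℝ) (μ : ℝ → ℝ → ℝ) (ρ : ℝ),
        -- the complete hot branch of BRANCH-PARAM (LEAD g15 `exists_complete_hotBranch_of_ridge`)
        ((ContDiff ℝ 2 γ ∧ γ 0 = 0 ∧ (∀ s, γ s 2 = 0) ∧ (∀ s, ‖deriv γ s‖ = 1) ∧ (∀ s, v (-1) (γ s) 2 = v (-1) 0 2) ∧
          (∀ s, fderiv ℝ (fderiv ℝ (fun y => σ * v (-1) y 2)) (γ s) (WithLp.toLp 2 ![-(deriv γ s 1), deriv γ s 0, 0])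
            (WithLp.toLp 2 ![-(deriv γ s 1), deriv γ s 0, 0]) = -κ) ∧
          (∀ s w, fderiv ℝ (fderiv ℝ (fun y => σ * v (-1) y 2)) (γ s) (deriv γ s) w = 0)) ∧ StrictMono φ ∧
        -- the hull limit (pinned, peakless, same hot value), slices converging locally uniformly, re-based branches converging to `Γ`
        (Literature.Analysis.FluidPDE.HasTypeITimeDecay C U ∧
          ContinuousOn (Function.uncurry U) (Set.Iio (0 : ℝ) ×ˢ Set.univ) ∧
          (∀ s t : ℝ, s < t → t < 0 → ∀ x, U t x =
            Literature.Analysis.UnboundedOperators.heatExtension (U s) (t - s) x -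
              Literature.Analysis.FluidPDE.oseenDuhamel 1 s U U t x) ∧
          (∀ t < 0, Literature.Analysis.FluidPDE.VectorCalculus.IsDivFree (U t)) ∧
          (∀ s < 0, ∀ q, ⟪Literature.Analysis.FluidPDE.curl (U s) q, EuclideanSpace.single 2 1⟫_ℝ = 0) ∧
          U (-1) 0 2 ≠ 0 ∧ (∀ t < 0, ∀ x, Real.sqrt (-t) * |U t x 2| ≤ |U (-1) 0 2|) ∧
          (∀ h : EuclideanSpace ℝ (Fin 3), fderiv ℝ (U (-1)) 0 h 2 = 0) ∧
          (deriv (fun s => U s 0 2) (-1) = U (-1) 0 2 / 2 ∧ U (-1) 0 2 * (Δ (fun q => U (-1) q 2)) 0 ≤ 0)) ∧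
        (∀ (s z₀ σ M : ℝ) (K O : Set (EuclideanSpace ℝ (Fin 3))), s < 0 →
          ((σ = 1 ∨ σ = -1) ∧ IsCompact K ∧ K.Nonempty ∧ (∀ q ∈ K, q 2 = z₀ ∧ σ * U s q 2 = M) ∧
            IsOpen O ∧ K ⊆ O ∧ (∀ q ∈ O, q 2 = z₀ → σ * U s q 2 ≤ M) ∧
            (∀ q ∈ O, q 2 = z₀ → σ * U s q 2 = M → q ∈ K)) → False) ∧
        U (-1) 0 2 = v (-1) 0 2 ∧
        (∀ t < 0, TendstoLocallyUniformly (fun j x => v t (x + γ ((φ j : ℕ) : ℝ))) (U t) atTop) ∧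
        (∀ s, Tendsto (fun j => γ (((φ j : ℕ) : ℝ) + s) - γ ((φ j : ℕ) : ℝ)) atTop (𝓝 (Γ s))) ∧
        -- re-entry package of the limit branch
        (∀ y ∈ {y : EuclideanSpace ℝ (Fin 3) | y 2 = 0 ∧ U (-1) y 2 = U (-1) 0 2}, fderiv ℝ (fun x => U (-1) x 2) y = 0) ∧
        ContDiff ℝ ∞ Γ ∧ Γ 0 = 0 ∧ (∀ s, Γ s 2 = 0) ∧ (∀ s, ‖deriv Γ s‖ = 1) ∧ (∀ s, U (-1) (Γ s) 2 = U (-1) 0 2) ∧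
        (∀ s, νΓ s = WithLp.toLp 2 ![-(deriv Γ s 1), deriv Γ s 0, 0]) ∧
        (∀ s, κ ≤ -(fderiv ℝ (fderiv ℝ (fun y => σ * U (-1) y 2)) (Γ s) (νΓ s) (νΓ s))) ∧
        -- the signed space–time component, the homogeneous ridge height, the tube radius, the window, the level
        (F = fun τ y => σ * U (-1 + τ) y 2) ∧
        (∀ τ z, R τ z = sSup ((fun n : ℝ => F τ (Γ 0 + n • νΓ 0 + z • EuclideanSpace.single 2 (1 : ℝ))) '' Icc (-r) r)) ∧
        0 < r ∧ 0 < δ ∧ δ ≤ 1 / 4 ∧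
        -- (Q3∞): the cross-section maximum is homogeneous along `Γ`
        (∀ τ z : ℝ, |τ| < δ → |z| < δ → ∀ s : ℝ,
          sSup ((fun n : ℝ => F τ (Γ s + n • νΓ s + z • EuclideanSpace.single 2 (1 : ℝ))) '' Icc (-r) r) = R τ z) ∧
        -- cold lateral values, hot centre
        (∀ τ z : ℝ, |τ| < δ → |z| < δ → ∀ s n : ℝ, (n = r ∨ n = -r) → F τ (Γ s + n • νΓ s + z • EuclideanSpace.single 2 (1 : ℝ)) < m) ∧
        (∀ τ z : ℝ, |τ| < δ → |z| < δ → ∀ s : ℝ, m ≤ F τ (Γ s + z • EuclideanSpace.single 2 (1 : ℝ))) ∧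
        -- strict concavity of the cross-sections on the open tube
        (∀ τ z : ℝ, |τ| < δ → |z| < δ → ∀ s : ℝ, ∀ n ∈ Ioo (-r) r,
          fderiv ℝ (fderiv ℝ (F τ)) (Γ s + n • νΓ s + z • EuclideanSpace.single 2 (1 : ℝ)) (νΓ s) (νΓ s) < 0) ∧
        -- THE WEB FERMAT LAW at every cross-section
        (∀ τ₀ z₀ : ℝ, |τ₀| < δ → |z₀| < δ → ∀ s₀ : ℝ, ∃ n₀ ∈ Ioo (-r) r,
          F τ₀ (Γ s₀ + n₀ • νΓ s₀ + z₀ • EuclideanSpace.single 2 (1 : ℝ)) = R τ₀ z₀ ∧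
          (∀ n ∈ Icc (-r) r, n ≠ n₀ → F τ₀ (Γ s₀ + n • νΓ s₀ + z₀ • EuclideanSpace.single 2 (1 : ℝ)) < R τ₀ z₀) ∧
          DifferentiableAt ℝ (uncurry R) (τ₀, z₀) ∧
          fderiv ℝ (uncurry F) (τ₀, Γ s₀ + n₀ • νΓ s₀ + z₀ • EuclideanSpace.single 2 (1 : ℝ)) =
            (fderiv ℝ (uncurry R) (τ₀, z₀)).comp
              ((ContinuousLinearMap.fst ℝ ℝ (EuclideanSpace ℝ (Fin 3))).prod
                ((EuclideanSpace.proj (2 : Fin 3)).comp (ContinuousLinearMap.snd ℝ ℝ (EuclideanSpace ℝ (Fin 3)))))) ∧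
        -- (TH) STRUCTURE OF THE HULL ELEMENT: the global bilinear identity, the frozen law, and the slope function of `v` on a uniform slab — the SAME `μ` for `U`
        (∀ t < 0, ∀ x x' : EuclideanSpace ℝ (Fin 3), x 2 = x' 2 → ∀ b c : Fin 3, b ≠ 2 → c ≠ 2 →
          fderiv ℝ (U t) x (EuclideanSpace.single 2 1) b * fderiv ℝ (U t) x' (EuclideanSpace.single c 1) 2 =
            fderiv ℝ (U t) x' (EuclideanSpace.single 2 1) c * fderiv ℝ (U t) x (EuclideanSpace.single b 1) 2) ∧
        (∀ s < 0, ∀ y, ⟪fderiv ℝ (U s) y (Literature.Analysis.FluidPDE.curl (U s) y), EuclideanSpace.single 2 1⟫_ℝ = 0) ∧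
        0 < ρ ∧ ρ ≤ 1 ∧ ContDiff ℝ 3 (uncurry μ) ∧
        μ (-1) 0 = fderiv ℝ (v (-1)) y₁ (EuclideanSpace.single 2 1) c₁ / fderiv ℝ (v (-1)) y₁ (EuclideanSpace.single c₁ 1) 2 ∧
        (∀ t : ℝ, |t + 1| < ρ → ∀ x : EuclideanSpace ℝ (Fin 3), |x 2| < ρ → ∀ b : Fin 3, b ≠ 2 →
          fderiv ℝ (v t) x (EuclideanSpace.single 2 1) b = μ t (x 2) * fderiv ℝ (v t) x (EuclideanSpace.single b 1) 2) ∧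
        (∀ t : ℝ, |t + 1| < ρ → ∀ x : EuclideanSpace ℝ (Fin 3), |x 2| < ρ → ∀ b : Fin 3, b ≠ 2 →
          fderiv ℝ (U t) x (EuclideanSpace.single 2 1) b = μ t (x 2) * fderiv ℝ (U t) x (EuclideanSpace.single b 1) 2) ∧
        (∀ t₀ : ℝ, |t₀ + 1| < ρ → ∀ y₀ : EuclideanSpace ℝ (Fin 3), y₀ 2 = 0 →
          ∀ᶠ z in 𝓝 ((t₀, y₀) : ℝ × EuclideanSpace ℝ (Fin 3)), ∀ b : Fin 3, b ≠ 2 →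
            fderiv ℝ (U z.1) z.2 (EuclideanSpace.single 2 1) b = μ z.1 (z.2 2) * fderiv ℝ (U z.1) z.2 (EuclideanSpace.single b 1) 2)) ∧
        -- (v9) the sub-cell
        ¬ (∀ s : ℝ, Γ s = s • deriv Γ 0) ∧ ¬ (∃ a b : ℝ, ∀ z : ℝ, |z| < δ → R 0 z = a + b * z) ∧
        -- (v13) the sub-sub-cell: APERIODIC curvature (research)
        ¬ (∃ L : ℝ, L ≠ 0 ∧ ∀ s : ℝ, ⟪deriv (deriv Γ) (s + L), νΓ (s + L)⟫_ℝ = ⟪deriv (deriv Γ) s, νΓ s⟫_ℝ) ∧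
        -- (v16) the sub-sub-sub-cell: the critical sheet of the hot time IS VERTICAL over Γ near z = 0 (RESEARCH residue of the (Q4) column)
        (∃ δᵥ : ℝ, 0 < δᵥ ∧ ∀ s z : ℝ, |z| < δᵥ → F 0 (Γ s + z • EuclideanSpace.single 2 (1 : ℝ)) = R 0 z) ∧
        -- (v17) the sub⁴-cell: NO scaling limit (scales ≥ 1) of the hull element carries a flat vertical curtain at time −1 (RESEARCH residue)
        ¬ (∃ (lam : ℕ → ℝ) (Wl : ℝ → EuclideanSpace ℝ (Fin 3) → EuclideanSpace ℝ (Fin 3)) (p e : EuclideanSpace ℝ (Fin 3)),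
          (∀ n : ℕ, 1 ≤ lam n) ∧
          (∀ t < 0, TendstoLocallyUniformly (fun n : ℕ => Literature.Analysis.FluidPDE.nsRescale (lam n) U t) (Wl t) atTop) ∧
          e 2 = 0 ∧ e ≠ 0 ∧
          (∀ s z : ℝ, ∀ w : EuclideanSpace ℝ (Fin 3), w 2 = 0 →
            fderiv ℝ (fun y => Wl (-1) y 2) (p + s • e + z • EuclideanSpace.single 2 (1 : ℝ)) w = 0) ∧
          (∀ s z : ℝ, ∀ b : Fin 3, b ≠ 2 →
            fderiv ℝ (Wl (-1)) (p + s • e + z • EuclideanSpace.single 2 (1 : ℝ)) (EuclideanSpace.single 2 1) b = 0)) ∧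
        -- (v18) the sub⁵-cell: the curvature of the base curve FLATTENS along arcs around a sequence of base points (CLOSABLE: LEMMA T)
        (∃ a : ℕ → ℝ, ∀ A ε : ℝ, 0 < ε → ∀ᶠ n in atTop, ∀ s : ℝ, |s| ≤ A → ‖deriv (deriv Γ) (a n + s)‖ ≤ ε)) →
        False := by
  intro C v W hv hW hbil hpeak hfrozen hHcl hHgrad hHcomp hHiso hHcurl σ κ y₁ c₁ hσ hσN hκ hHlap hy₁ hc₁ hslope₁ hobj
  obtain ⟨γ, φ, U, Γ, νΓ, F, R, r, δ, m, μ, ρ, ⟨-, -, hUclass, -, hUN, -, -, hUcrit, hΓ, -, hΓ2, hΓunit, hΓhot, hν, hΓcurv, hFdef, -,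
    hr, hδ, hδ4, -, -, -, hconc, hweb, hUbil, -, hρ, -, hμ3, -, -, hslabU, hevU⟩, -, -, -, hV, -, hY⟩ := hobj
  obtain ⟨hUrate, hUcont, hUmild, hUdiv, hUpol, hUne, hUhotbd, -, -⟩ := hUclass
  have hσN' : σ * U (-1) 0 2 = |U (-1) 0 2| := by rw [hUN, hσN]
  subst hFdef
  have hV' : ∃ δᵥ : ℝ, 0 < δᵥ ∧ ∀ s z : ℝ, |z| < δᵥ → σ * U (-1) (Γ s + z • EuclideanSpace.single 2 (1 : ℝ)) 2 = R 0 z := by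
    simpa only [add_zero] using hV
  -- B-TWP0c: the space–time web function over `Γ` and the identities at its web points
  obtain ⟨δ', n₀, κt, k, d, K, hδ', -, -, -, -, -, -, -, -, -, hbox, -⟩ :=
    curved_time_web_package hUrate hUcont hUmild hUdiv hUpol hUne hUhotbd hUcrit hσ hσN' hκ hΓ hΓ2 hΓunit hΓhot hν hΓcurv hr hδ hconc hweb hρ hμ3
      hslabU hevU
  -- (E1): the whole cylinder `Γ × ℝ` is horizontally critical
  obtain ⟨δ₁, -, -, -, hE1, -⟩ := vertical_entrance hUrate hUcont hUmild hUdiv hUpol hρ hslabU hσ hΓ hΓ2 hΓunit hr hδ' hbox hV'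
  -- LEMMA T
  exact false_of_translationFlat_curtain hUrate hUcont hUmild hUdiv hUpol hUne hUbil (hΓ.of_le (by norm_cast)) hΓ2 hΓunit hΓhot hE1 hY

end Summit.NavierStokesRegularity.NavierStokesRegularity.Theorems.PoloidalWindowDoorLrcModEntireQ4CurvedAperiodicVerticalCurvedLimitsTranslationFlatStub

end
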